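import Literature.IUT.LogVolume.GenuineLogThetaPerImageStepV
import HarnessLib

/-!
# `−|log(Θ)|` in the per-(slot-)image reading (P) is WELL-DEFINED: every (Ind1)-slot datum gives the same number

[IUTchIII] Cor. 3.12, proof, Step (x) (RIMS ms May 2020, p. 181 l. 2–32): «the resulting log-volumes ∈ ℝ are invariant
with respect to the indeterminacies (Ind1), (Ind2)»; Prop. 3.9 (i) p. 116 / (iii) p. 117: «μ^log_{A,v_ℚ} is invariant
with respect to permutations of A»; [IUTchIV] Thm. 1.10 Step (v) p. 28: «after passing to weighted averages, the
operation of symmetrizing with respect to the choice of “i† ∈ I” in S±_{j+1} does not affect the computation». Dupuy–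
Hilado, arXiv:2004.13228 §4.7 ((Ind1) = the factor permutations `K_{v̲∘σ} → K_{v̲}`, which «fix the lattice»), §4.9
((Ind2) = `Aut_{ℚ_p}(K_{v⃗} : I_{v⃗})`), §4.12 (the hull).

`GenuineLogThetaPerImage.lean` (abc-iut-S7) defines reading (P) with the IDENTITY slot datum: the hull of
`⋃_{g ∈ G₂(v⃗)} g·O_𝕃(−P_Θ)_{v⃗}`. An arbitrary (Ind1)-element `σ = (σ_j)_j` produces instead, in the summand `v⃗`, the
region `⋃_{g ∈ G₂(v⃗)} g·perm_σ(O_𝕃(−P_Θ)_{v⃗∘σ})` (theta value at the slot `σ(j)`). THIS FILE proves, on the REAL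
packet, that the two give THE SAME log-volume after the weighted average over collections — so `−|log(Θ)|_(P)` does
not depend on the slot datum, as reading (P) requires and as the three sentences above say:
* `image_perm_iUnion_indTwo_smul` — (Ind1) conjugates (Ind2): `perm_σ(⋃_{g'} g'·A) = ⋃_g g·perm_σ(A)` (`g ↦ σgσ⁻¹`
  is a bijection `Aut(V' : log_p R'^×) ≅ Aut(V : log_p R^×)` since `perm_σ` maps `log_p(R'^×)` onto `log_p(R^×)`);
* `image_perm_packetHull` — (Ind1) commutes with the holomorphic hull: `perm_σ(hull(S)) = hull(perm_σ(S))` (`perm_σ`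
  is a RING isomorphism carrying `(R_I)^∼` to `(R_I)^∼`; through abc-iut-S2's bridge `image_packetHull_eq_lanaHull`
  along the decompositions `ψ` and `ψ ∘ perm_σ`);
* `realPrimePacketWith_logμ_slotHull_perm` — hence, with `log μ̄ ∘ perm_σ = log μ̄` (`packetLogμ_image_perm`), the
  `v⃗`-component of the `σ`-slot hull of ANY region `B` has the log-volume of the `v⃗∘σ`-component of its
  identity-slot hull;
* `realPrimePacketWith_lnνTensorPower_slot_perm`, `realPrimePacketWith_lnνLp_slot_perm` — re-indexing the weighted
  sum over collections along `v⃗ ↦ v⃗∘σ` (product weights are permutation invariant): `ln ν̄` of the `σ`-slot hull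
  region equals `ln ν̄` of `slotImagesHull B`, for every `σ = (σ_j)_j`;
* **`ThetaVolumeInput.negLogThetaPerImageLoc_perm`, `negLogThetaPerImageNonarch_perm`** — for a genuine input, the
  nonarchimedean `−|log(Θ)|_(P)` computed with ANY slot data `σ_{p,j} ∈ 𝔖_{j+1}` equals `negLogThetaPerImageNonarch I`.
THEOREMS ONLY (abc-iut cell, campaign-S seat abc-iut-S7; abc-iut-plan ruling 2026-08-26T02:51:47Z (2)(b)
`negLogThetaPerImage_perm`); no side taken on [IUTchIII] Cor. 3.12; typed ≠ endorsed.
[cite: Mochizuki2012, IUTchIII Cor. 3.12 proof Step (x) p. 181] [cite: Mochizuki2012, IUTchIII Prop. 3.9 (i) p. 116]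
[cite: Mochizuki2012, IUTchIV Thm. 1.10 Step (v) p. 28] [cite: DupuyHilado2025, §4.7, §4.9, §4.12]
-/

noncomputable section

open Set MeasureTheory NumberField IsDedekindDomain
open scoped Pointwise TensorProduct

namespace Literature.IUT.LogVolume

/-! ## Packet level: (Ind1) conjugates (Ind2) and commutes with the hull -/

section Packet

variable (p : ℕ) [Fact p.Prime]
variable {I : Type} [Fintype I] [DecidableEq I]
variable (s : I → Type) [∀ i, NontriviallyNormedField (s i)] [∀ i, NormedAlgebra ℚ_[p] (s i)]
  [∀ i, IsUltrametricDist (s i)] [∀ i, ProperSpace (s i)]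
variable (σ : Equiv.Perm I)

omit [Fintype I] [DecidableEq I] [∀ i, IsUltrametricDist (s i)] [∀ i, ProperSpace (s i)] in
/-- `perm_σ(y) ∈ log_p(R_I^×) ↔ y ∈ log_p(R'^×)` (from `image_logPacket_perm` and injectivity).
[cite: DupuyHilado2025, §4.7] -/
theorem perm_mem_logPacket_iff (y : PacketAlgebra p (fun i ↦ s (σ i))) :
    permAlgEquiv p s σ y ∈ logPacket p s ↔ y ∈ logPacket p (fun i ↦ s (σ i)) := by
  constructor
  · intro h
    have h' : permAlgEquiv p s σ y ∈
        permAlgEquiv p s σ '' (logPacket p (fun i ↦ s (σ i)) : Set (PacketAlgebra p (fun i ↦ s (σ i)))) := by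
      rw [image_logPacket_perm]; exact h
    obtain ⟨y', hy', he⟩ := h'
    rwa [← (permAlgEquiv p s σ).injective he]
  · intro h
    have h' : permAlgEquiv p s σ y ∈
        permAlgEquiv p s σ '' (logPacket p (fun i ↦ s (σ i)) : Set (PacketAlgebra p (fun i ↦ s (σ i)))) :=
      ⟨y, h, rfl⟩
    rwa [image_logPacket_perm] at h'

omit [Fintype I] [DecidableEq I] [∀ i, IsUltrametricDist (s i)] [∀ i, ProperSpace (s i)] in
/-- `perm_σ⁻¹(v) ∈ log_p(R'^×) ↔ v ∈ log_p(R_I^×)`. [cite: DupuyHilado2025, §4.7] -/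
theorem symm_perm_mem_logPacket_iff (v : PacketAlgebra p s) :
    (permAlgEquiv p s σ).symm v ∈ logPacket p (fun i ↦ s (σ i)) ↔ v ∈ logPacket p s := by
  rw [← perm_mem_logPacket_iff p s σ, AlgEquiv.apply_symm_apply]

omit [Fintype I] [DecidableEq I] [∀ i, IsUltrametricDist (s i)] [∀ i, ProperSpace (s i)] in
/-- **(Ind1) conjugates (Ind2)**: `perm_σ(⋃_{g'} g'·A) = ⋃_g g·perm_σ(A)`, the unions over the (Ind2) groups
`Aut_{ℚ_p}(V' : log_p(R'^×))` of the permuted summand and `Aut_{ℚ_p}(V : log_p(R^×))` of the target summand — conjugation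
by the lattice-preserving `perm_σ` is a bijection between the two groups. [cite: DupuyHilado2025, §4.7, §4.9] -/
theorem image_perm_iUnion_indTwo_smul (A : Set (PacketAlgebra p (fun i ↦ s (σ i)))) :
    permAlgEquiv p s σ '' (⋃ g' : indTwo p (fun i ↦ s (σ i)), g' • A) =
      ⋃ g : indTwo p s, g • (permAlgEquiv p s σ '' A) := by
  set φL : PacketAlgebra p (fun i ↦ s (σ i)) ≃ₗ[ℚ_[p]] PacketAlgebra p s := (permAlgEquiv p s σ).toLinearEquiv
    with hφL
  ext x
  simp only [Set.mem_image, Set.mem_iUnion]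
  constructor
  · rintro ⟨y, ⟨g', hy⟩, rfl⟩
    rw [indTwo_smul_set] at hy
    obtain ⟨a, ha, rfl⟩ := hy
    -- the conjugate `perm ∘ g' ∘ perm⁻¹` lies in the (Ind2) group of the target summand
    let G : PacketAlgebra p s ≃ₗ[ℚ_[p]] PacketAlgebra p s :=
      φL.symm.trans ((g' : PacketAlgebra p (fun i ↦ s (σ i)) ≃ₗ[ℚ_[p]] PacketAlgebra p (fun i ↦ s (σ i))).trans φL)
    have hGv : ∀ v, G v = permAlgEquiv p s σ
        ((g' : PacketAlgebra p (fun i ↦ s (σ i)) ≃ₗ[ℚ_[p]] PacketAlgebra p (fun i ↦ s (σ i)))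
          ((permAlgEquiv p s σ).symm v)) := fun v => rfl
    have hG : G ∈ indTwo p s := by
      rw [mem_indTwo_iff]
      intro v
      rw [hGv, perm_mem_logPacket_iff, (mem_indTwo_iff p _ _).1 g'.2, symm_perm_mem_logPacket_iff]
    refine ⟨⟨G, hG⟩, ?_⟩
    rw [indTwo_smul_set]
    refine ⟨permAlgEquiv p s σ a, ⟨a, ha, rfl⟩, ?_⟩
    show G (permAlgEquiv p s σ a) = permAlgEquiv p s σ
      ((g' : PacketAlgebra p (fun i ↦ s (σ i)) ≃ₗ[ℚ_[p]] PacketAlgebra p (fun i ↦ s (σ i))) a)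
    rw [hGv, AlgEquiv.symm_apply_apply]
  · rintro ⟨g, hx⟩
    rw [indTwo_smul_set] at hx
    obtain ⟨b, ⟨a, ha, rfl⟩, rfl⟩ := hx
    -- the conjugate `perm⁻¹ ∘ g ∘ perm` lies in the (Ind2) group of the permuted summand
    let G' : PacketAlgebra p (fun i ↦ s (σ i)) ≃ₗ[ℚ_[p]] PacketAlgebra p (fun i ↦ s (σ i)) :=
      φL.trans ((g : PacketAlgebra p s ≃ₗ[ℚ_[p]] PacketAlgebra p s).trans φL.symm)
    have hG'v : ∀ v, G' v = (permAlgEquiv p s σ).symm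
        ((g : PacketAlgebra p s ≃ₗ[ℚ_[p]] PacketAlgebra p s) (permAlgEquiv p s σ v)) := fun v => rfl
    have hG' : G' ∈ indTwo p (fun i ↦ s (σ i)) := by
      rw [mem_indTwo_iff]
      intro v
      rw [hG'v, symm_perm_mem_logPacket_iff, (mem_indTwo_iff p s _).1 g.2, perm_mem_logPacket_iff]
    refine ⟨G' a, ⟨⟨G', hG'⟩, ?_⟩, ?_⟩
    · rw [indTwo_smul_set]
      exact ⟨a, ha, rfl⟩
    · rw [hG'v, AlgEquiv.apply_symm_apply]

variable [Nonempty I]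

/-- **(Ind1) commutes with the holomorphic hull**: `perm_σ(hull(S)) = hull(perm_σ(S))` for every `S` — `perm_σ` is a
`ℚ_p`-algebra isomorphism carrying `(R_I)^∼` onto `(R_I)^∼`, so it carries the smallest `(R_I)^∼`-module through `S`
to the smallest `(R_I)^∼`-module through `perm_σ(S)` (read through abc-iut-S2's bridge `image_packetHull_eq_lanaHull`
along the decompositions `ψ` of the target and `ψ ∘ perm_σ` of the source). [cite: DupuyHilado2025, §4.7, §4.12] -/
theorem image_perm_packetHull (S : Set (PacketAlgebra p (fun i ↦ s (σ i)))) :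
    permAlgEquiv p s σ '' packetHull p (fun i ↦ s (σ i)) S = packetHull p s (permAlgEquiv p s σ '' S) := by
  apply (dEquiv p s).injective.image_injective
  have hcomp : ∀ X : Set (PacketAlgebra p (fun i ↦ s (σ i))),
      ((permAlgEquiv p s σ).trans (dEquiv p s)) '' X = dEquiv p s '' (permAlgEquiv p s σ '' X) := by
    intro X
    rw [Set.image_image]
    rfl
  have h1 := image_packetHull_eq_lanaHull p (fun i ↦ s (σ i)) (DFac p s)
    ((permAlgEquiv p s σ).trans (dEquiv p s)) S
  have h2 := image_packetHull_eq_lanaHull p s (DFac p s) (dEquiv p s) (permAlgEquiv p s σ '' S)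
  rw [hcomp, hcomp] at h1
  rw [h1, h2]

end Packet

/-! ## The real packet: the `σ`-slot hull has the log-volume of the identity-slot hull -/

section RealPacketWith

variable {F : Type} [Field F] [NumberField F]
variable (p : ℕ) [Fact p.Prime] (𝔽 : LocalFields F p)
variable (c : (j : ℕ) → (Fin (j + 1) → placesOver F p) → ℚ_[p]) (hc0 : ∀ j e, c j e ≠ 0)
  (hcσ : ∀ (j : ℕ) (σ : Equiv.Perm (Fin (j + 1))) (e : Fin (j + 1) → placesOver F p), c j (e ∘ σ) = c j e)

/-- **The `σ`-slot hull and the identity-slot hull have the same log-volume, component by component up to the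
relabelling `v⃗ ↦ v⃗∘σ`.** For any region `B` of the real packet, degree `j`, permutation `σ ∈ 𝔖_{j+1}` and collection
`v⃗`: `log μ̄_{v⃗}(hull(⋃_{g∈G₂(v⃗)} g·perm_σ(B_{v⃗∘σ}))) = log μ̄_{v⃗∘σ}(hull(⋃_{g'∈G₂(v⃗∘σ)} g'·B_{v⃗∘σ}))`.
[cite: Mochizuki2012, IUTchIII Prop. 3.9 (i) p. 116] -/
theorem realPrimePacketWith_logμ_slotHull_perm {j : ℕ} (σ : Equiv.Perm (Fin (j + 1)))
    (e : Fin (j + 1) → placesOver F p) (B : (realPrimePacketWith p 𝔽 c hc0 hcσ).Region) :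
    (realPrimePacketWith p 𝔽 c hc0 hcσ).logμ ((realPrimePacketWith p 𝔽 c hc0 hcσ).hullLoc j e
        (⋃ g : (realPrimePacketWith p 𝔽 c hc0 hcσ).G₂ j e,
          g • ((realPrimePacketWith p 𝔽 c hc0 hcσ).perm σ e '' B j (e ∘ σ)))) =
      (realPrimePacketWith p 𝔽 c hc0 hcσ).logμ ((realPrimePacketWith p 𝔽 c hc0 hcσ).slotImagesHull B j (e ∘ σ)) := by
  haveI : Nonempty (Fin (j + 1)) := ⟨0⟩
  -- read the region of the permuted summand in the packet `⊗_i K_{v̲_{σ(i)}}` (definitionally the same type)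
  set A : Set (PacketAlgebra p (fun i => 𝔽.k (e (σ i)))) := B j (e ∘ σ) with hA
  have h1 : (⋃ g : (realPrimePacketWith p 𝔽 c hc0 hcσ).G₂ j e,
      g • ((realPrimePacketWith p 𝔽 c hc0 hcσ).perm σ e '' B j (e ∘ σ))) =
      permAlgEquiv p (fun i => 𝔽.k (e i)) σ '' (⋃ g' : indTwo p (fun i => 𝔽.k (e (σ i))), g' • A) :=
    (image_perm_iUnion_indTwo_smul p (fun i => 𝔽.k (e i)) σ A).symm
  have key : packetLogμ p (fun i => 𝔽.k (e i)) (packetHull p (fun i => 𝔽.k (e i))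
      (permAlgEquiv p (fun i => 𝔽.k (e i)) σ '' (⋃ g' : indTwo p (fun i => 𝔽.k (e (σ i))), g' • A))) =
    packetLogμ p (fun i => 𝔽.k (e (σ i))) (packetHull p (fun i => 𝔽.k (e (σ i)))
      (⋃ g' : indTwo p (fun i => 𝔽.k (e (σ i))), g' • A)) := by
    rw [← image_perm_packetHull, packetLogμ_image_perm]
  exact (congrArg (fun S : Set (PacketAlgebra p (fun i => 𝔽.k (e i))) =>
    packetLogμ p (fun i => 𝔽.k (e i)) (packetHull p (fun i => 𝔽.k (e i)) S)) h1).trans key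

/-- **`ln ν̄_{𝔸^{⊗ j+1}}` of the `σ`-slot hull region equals that of the identity-slot hull region** (re-index the
weighted sum over collections along the bijection `v⃗ ↦ v⃗∘σ`; the product weights are permutation invariant).
[cite: Mochizuki2012, IUTchIII Prop. 3.9 (i) p. 116] -/
theorem realPrimePacketWith_lnνTensorPower_slot_perm (j : ℕ) (σ : Equiv.Perm (Fin (j + 1)))
    (B : (realPrimePacketWith p 𝔽 c hc0 hcσ).Region) :
    (∑ e : Fin (j + 1) → placesOver F p,
        (realPrimePacketWith p 𝔽 c hc0 hcσ).logμ ((realPrimePacketWith p 𝔽 c hc0 hcσ).hullLoc j e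
          (⋃ g : (realPrimePacketWith p 𝔽 c hc0 hcσ).G₂ j e,
            g • ((realPrimePacketWith p 𝔽 c hc0 hcσ).perm σ e '' B j (e ∘ σ)))) *
          ∏ i, weight F (e i).1) =
      ∑ e : Fin (j + 1) → placesOver F p,
        (realPrimePacketWith p 𝔽 c hc0 hcσ).logμ ((realPrimePacketWith p 𝔽 c hc0 hcσ).slotImagesHull B j e) *
          ∏ i, weight F (e i).1 := by
  have h1 : ∀ e : Fin (j + 1) → placesOver F p,
      (realPrimePacketWith p 𝔽 c hc0 hcσ).logμ ((realPrimePacketWith p 𝔽 c hc0 hcσ).hullLoc j e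
          (⋃ g : (realPrimePacketWith p 𝔽 c hc0 hcσ).G₂ j e,
            g • ((realPrimePacketWith p 𝔽 c hc0 hcσ).perm σ e '' B j (e ∘ σ)))) * ∏ i, weight F (e i).1 =
        (realPrimePacketWith p 𝔽 c hc0 hcσ).logμ ((realPrimePacketWith p 𝔽 c hc0 hcσ).slotImagesHull B j (e ∘ σ)) *
          ∏ i, weight F ((e ∘ σ) i).1 := by
    intro e
    rw [realPrimePacketWith_logμ_slotHull_perm, IndPacketModel.prod_weight_comp_perm]
  simp_rw [h1]
  -- reindex the sum along the bijection `e ↦ e ∘ σ`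
  exact Function.Bijective.sum_comp (Equiv.arrowCongr σ (Equiv.refl _)).symm.bijective
    (fun e => (realPrimePacketWith p 𝔽 c hc0 hcσ).logμ
      ((realPrimePacketWith p 𝔽 c hc0 hcσ).slotImagesHull B j e) * ∏ i, weight F (e i).1)

/-- **`ln ν̄_{𝕃_p}` of the slot-hull region does not depend on the slot data**: for every choice `σ = (σ_j)_j` of an
(Ind1)-element, the procession-normalised log-volume of the region `⋃_g g·perm_{σ_j}(B_{v⃗∘σ_j})` (then hull) equals
that of `slotImagesHull B`. [cite: Mochizuki2012, IUTchIII Cor. 3.12 proof Step (x) p. 181] -/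
theorem realPrimePacketWith_lnνLp_slot_perm (lstar : ℕ) (σ : (j : ℕ) → Equiv.Perm (Fin (j + 1)))
    (B : (realPrimePacketWith p 𝔽 c hc0 hcσ).Region) :
    (realPrimePacketWith p 𝔽 c hc0 hcσ).lnνLp lstar (fun j e => (realPrimePacketWith p 𝔽 c hc0 hcσ).hullLoc j e
        (⋃ g : (realPrimePacketWith p 𝔽 c hc0 hcσ).G₂ j e,
          g • ((realPrimePacketWith p 𝔽 c hc0 hcσ).perm (σ j) e '' B j (e ∘ σ j)))) =
      (realPrimePacketWith p 𝔽 c hc0 hcσ).lnνLp lstar ((realPrimePacketWith p 𝔽 c hc0 hcσ).slotImagesHull B) := by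
  unfold PrimePacket.lnνLp PrimePacket.lnνTensorPower
  congr 1
  refine Finset.sum_congr rfl fun i _ => ?_
  exact realPrimePacketWith_lnνTensorPower_slot_perm p 𝔽 c hc0 hcσ ((i : ℕ) + 1) (σ ((i : ℕ) + 1)) B

end RealPacketWith

/-! ## The genuine input: `−|log(Θ)|_(P)` does not depend on the slot data -/

namespace ThetaVolumeInput

variable {F₀ : Type} [Field F₀] [NumberField F₀] {K : Type} [Field K] [NumberField K] [Algebra F₀ K]
variable (I : ThetaVolumeInput F₀ K)

/-- **`negLogThetaPerImage_perm`, at a prime**: the slot-hull volume of `O_𝕃(−div t_Θ)_p` computed with ANY slot data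
`σ = (σ_j)_j` (theta value moved to the slot `σ_j(j)` of each collection) equals the identity-slot summand
`negLogThetaPerImageLoc I p` — reading (P) is well-defined. [cite: Mochizuki2012, IUTchIII Cor. 3.12 proof Step (x) p. 181] -/
theorem negLogThetaPerImageLoc_perm {p : ℕ} (hp : p.Prime) (σ : (j : ℕ) → Equiv.Perm (Fin (j + 1))) :
    (I.packetAt p hp).lnνLp I.lstar (fun j e => (I.packetAt p hp).hullLoc j e
        (⋃ g : (I.packetAt p hp).G₂ j e,
          g • ((I.packetAt p hp).perm (σ j) e '' (I.packetAt p hp).pilotRegion (I.tΘ p hp) j (e ∘ σ j)))) =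
      I.negLogThetaPerImageLoc p := by
  haveI : Fact p.Prime := ⟨hp⟩
  rw [I.negLogThetaPerImageLoc_of_prime hp]
  exact realPrimePacketWith_lnνLp_slot_perm p (I.σ.localFieldFamily p hp) (mScale p _) (mScale_ne_zero p _)
    (mScale_perm p _) I.lstar σ ((I.packetAt p hp).pilotRegion (I.tΘ p hp))

/-- **`negLogThetaPerImage_perm`**: for a genuine input, the nonarchimedean `−|log(Θ)|_(P)` computed with ANY slot data
`σ_{p,j} ∈ 𝔖_{j+1}` (one (Ind1)-element per support prime) equals `negLogThetaPerImageNonarch I` — «the resulting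
log-volumes … are invariant with respect to the indeterminacies (Ind1), (Ind2)» for reading (P); the (Ind2)-part is the
union inside each component, the strip-automorphism part is among the `g`. [cite: Mochizuki2012, IUTchIII Cor. 3.12 proof Step (x) p. 181] -/
theorem negLogThetaPerImageNonarch_perm (σ : (p j : ℕ) → Equiv.Perm (Fin (j + 1))) :
    (∑ p ∈ I.supportPrimes, if hp : p.Prime then
        (I.packetAt p hp).lnνLp I.lstar (fun j e => (I.packetAt p hp).hullLoc j e
          (⋃ g : (I.packetAt p hp).G₂ j e,
            g • ((I.packetAt p hp).perm (σ p j) e '' (I.packetAt p hp).pilotRegion (I.tΘ p hp) j (e ∘ σ p j))))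
      else 0) = I.negLogThetaPerImageNonarch := by
  unfold negLogThetaPerImageNonarch
  refine Finset.sum_congr rfl fun p hp => ?_
  have hp' : p.Prime := I.prime_of_mem_supportPrimes hp
  rw [dif_pos hp', I.negLogThetaPerImageLoc_perm hp' (σ p)]

end ThetaVolumeInput

end Literature.IUT.LogVolume

end
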